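import Literature.Computability.QuantumComplexity.GoldenArithmetic
import Mathlib.Data.Int.Interval
import HarnessLib

/-!
# `ℤ[φ]` is discrete in `ℝ × ℝ` under the two real embeddings; numerical enclosures of `φ`, `ψ`

An extension of the tree's golden-integer arithmetic
(`Literature/Computability/QuantumComplexity/GoldenArithmetic.lean`: `ZPhi = QuadraticAlgebra ℤ 1 1`
with the embeddings `ZPhi.toReal` (`φ ↦ (1+√5)/2`) and `ZPhi.toConj` (`φ ↦ ψ = (1-√5)/2`) and the exact
sign test `ZPhi.pos`), used by the arithmetic hyperbolic reflection group `[5,3,3,5] ≤ GL₅(ℤ[φ])`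
(`Literature/Geometry/Hyperbolic/Coxeter5335*.lean`):

* `finite_abs_toReal_le` — **discreteness of `(toReal, toConj) : ℤ[φ] → ℝ × ℝ`**: only finitely many
  golden integers have both conjugates bounded (the image is a lattice in `ℝ²`; elementary:
  `(a + bφ) - (a + bψ) = b√5` bounds `b`, then `a`). This is the mechanism behind the discreteness of
  arithmetic groups over `ℤ[φ]` whose Galois-conjugate form is definite.
* rational enclosures `2.236 < √5 < 2.237`, `1.618 < φ < 1.619`, `-0.619 < ψ < -0.618` for
  inequalities with real (non-`ℤ[φ]`) coefficients.

Everything is proved; no named facts.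
-/

noncomputable section

namespace Literature.NumberTheory

open Literature.Computability.QuantumComplexity Real

/-! ### Numerical enclosures -/

/-- `2.236 < √5`. [folklore] -/
theorem sqrt_five_gt : (2236 : ℝ) / 1000 < √5 := by
  rw [Real.lt_sqrt (by norm_num)]; norm_num

/-- `√5 < 2.237`. [folklore] -/
theorem sqrt_five_lt : √5 < (2237 : ℝ) / 1000 := by
  rw [Real.sqrt_lt' (by norm_num)]; norm_num

/-- `1.618 < φ`. [folklore] -/
theorem goldenRatio_gt : (1618 : ℝ) / 1000 < goldenRatio := by
  rw [goldenRatio]; have := sqrt_five_gt; linarith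

/-- `φ < 1.619`. [folklore] -/
theorem goldenRatio_lt : goldenRatio < (1619 : ℝ) / 1000 := by
  rw [goldenRatio]; have := sqrt_five_lt; linarith

/-- `-0.619 < ψ`. [folklore] -/
theorem goldenConj_gt : (-619 : ℝ) / 1000 < goldenConj := by
  rw [goldenConj]; have := sqrt_five_lt; linarith

/-- `ψ < -0.618`. [folklore] -/
theorem goldenConj_lt : goldenConj < (-618 : ℝ) / 1000 := by
  rw [goldenConj]; have := sqrt_five_gt; linarith

/-! ### Discreteness of the pair of embeddings -/

/-- **The image of `ℤ[φ]` under `(toReal, toConj)` is discrete**: only finitely many golden integers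
have both real conjugates of absolute value at most `T` (`(a + bφ) - (a + bψ) = b √5` bounds `b`, then
`a`). [folklore] -/
theorem finite_abs_toReal_le (T : ℝ) :
    {x : ZPhi | |ZPhi.toReal x| ≤ T ∧ |ZPhi.toConj x| ≤ T}.Finite := by
  -- bound the coordinates: `|b| √5 ≤ 2T`, `|a| ≤ T + |b| φ`
  obtain ⟨N, hN⟩ : ∃ N : ℕ, 2 * T + 2 ≤ N := ⟨⌈2 * T + 2⌉₊, Nat.le_ceil _⟩
  have h5 : (1 : ℝ) ≤ √5 := by
    rw [Real.le_sqrt (by norm_num) (by norm_num)]; norm_num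
  have hφ2 := goldenRatio_lt_two
  have hφ0 := goldenRatio_pos
  refine (((Set.finite_Icc (-(3 * (N : ℤ))) (3 * N)).prod (Set.finite_Icc (-(N : ℤ)) N)).image
    (fun p : ℤ × ℤ ↦ (⟨p.1, p.2⟩ : ZPhi))).subset ?_
  rintro ⟨a, b⟩ ⟨h1, h2⟩
  simp only [ZPhi.toReal_apply, ZPhi.toConj_apply, abs_le] at h1 h2
  have hdiff : (b : ℝ) * √5 = (a + b * goldenRatio) - (a + b * goldenConj) := by
    rw [← goldenRatio_sub_goldenConj]; ring
  have hb : |(b : ℝ)| ≤ N := by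
    have : |(b : ℝ) * √5| ≤ 2 * T := by rw [hdiff, abs_le]; constructor <;> linarith
    rw [abs_mul, abs_of_pos (show (0 : ℝ) < √5 by positivity)] at this
    have hb1 : |(b : ℝ)| ≤ |(b : ℝ)| * √5 := le_mul_of_one_le_right (abs_nonneg _) h5
    linarith
  have ha : |(a : ℝ)| ≤ 3 * N := by
    have h3 : |(b : ℝ) * goldenRatio| ≤ 2 * N := by
      rw [abs_mul, abs_of_pos hφ0]; nlinarith [abs_nonneg (b : ℝ)]
    rw [abs_le] at h3 ⊢
    constructor <;> nlinarith
  rw [abs_le] at ha hb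
  refine ⟨(a, b), ⟨⟨?_, ?_⟩, ?_, ?_⟩, rfl⟩ <;>
    first
    | exact_mod_cast ha.1
    | exact_mod_cast ha.2
    | exact_mod_cast hb.1
    | exact_mod_cast hb.2

end Literature.NumberTheory
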